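import Mathlib
import Summits.Ventures.HSemireg.LineLawOneModFourSufficiency
import Summits.Ventures.HSemireg.LineLawGeneralCaptureAll

/-!
# LINE LAW — THEOREM A ∕ A′ «⇐» UNCONDITIONALLY on Euler's squarefree convenient numbers (ENGINE-W code B, #B27)

For `k` in Euler's list of 65 convenient numbers (tree `eulerConvenientNumbers`; one class per genus for `ℤ[√−k]` is the tree's
`decide`d check `LineLawPrincipalGenus.euler_forall_ambiguous`, k = 315) and `k` squarefree, the two assembled sufficiency theorems
— #B26 `lineLaw_sufficiency_two_three` (`k ≡ 1, 2 (mod 4)`, i.e. `m = −k ≡ 3, 2 (mod 4)`; no 2-adic hypothesis) and #B23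
`lineLaw_sufficiency_one_mod_four` (`k ≡ 3 (mod 4)`; even quotients of one exact 2-power) — hold with NO class-number hypothesis left:
* `lineLaw_sufficiency_euler` — `k ∈ eulerConvenientNumbers` squarefree; quotients `n`, each `x² + k y² > 0` with `x, y` coprime; if
  `k ≡ 3 (mod 4)`, all even quotients exactly divisible by one `2^e`.  THEN one integer `A` has every `n = N z` for a primitive
  `z ∈ ℤ√−k` dividing `A − √−k` — the 37 imaginary squarefree one-class-per-genus census orders (LINE-LAW-THEOREMS-B §7 ∕ scale test:
  «the imaginary clean orders are exactly Euler's 37 squarefree convenient numbers») obey THEOREM A ∕ A′ «⇐» in kernel, modulo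
  THEOREM CF⁶ by value;
* `capture_euler_all` — the per-weight capture on the same list, any weight (even ∕ ramified ∕ coprime), `n` or `k₀` odd.
Honest framing: integer ∕ `ℤ√m` arithmetic only; Mukai vectors and lattices elsewhere, not objects; nothing here says that HC, HC_CM
or HC_AV holds.
-/

namespace Summit.Ventures.HSemireg.LineLawEulerSufficiency

open Zsqrtd
open Literature.NumberTheory.QuadraticFields (BinaryQuadraticForm.classNumber)
open Literature.NumberTheory.QuadraticFields.BinaryQuadraticForm (assignedCharCount)
open Literature.NumberTheory.QuadraticFields.Quadratic
open Literature.Computability.Cryptography.Hallgren2005.OrderCl (NegDiscr)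
open Summit.Ventures.HSemireg.LineLawPrincipalGenus (euler_forall_ambiguous)
open Summit.Ventures.HSemireg.LineLawOneModFourSufficiency (lineLaw_sufficiency_one_mod_four)
open Summit.Ventures.HSemireg.LineLawGeneralCaptureAll (lineLaw_sufficiency_two_three capture_all_of_parity)

/-- **Euler's list gives the class-number criterion `h(−4k) = 2^{μ−1}`** (Cox Thm 3.22 (ii) ⟺ (iv) ⟺ (v), tree; the ambiguity of
every reduced form is 315's kernel-decided `euler_forall_ambiguous`). -/
theorem classNumber_eq_of_euler {k : ℕ} (hk : k ∈ eulerConvenientNumbers) :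
    BinaryQuadraticForm.classNumber (4 * (-(k : ℤ))) = 2 ^ (assignedCharCount (4 * (-(k : ℤ))) - 1) := by
  obtain ⟨hk0, h⟩ := euler_forall_ambiguous k hk
  rw [show (-4 * (k : ℤ)) = 4 * (-(k : ℤ)) by ring] at h
  let Δ : NegDiscr := ⟨4 * (-(k : ℤ)), by omega⟩
  have hD4 : Δ.D % 4 = 0 ∨ Δ.D % 4 = 1 := Or.inl (show (4 * (-(k : ℤ))) % 4 = 0 by omega)
  exact (forall_sq_eq_one_iff_classNumber_eq Δ hD4).1 ((forall_ambiguous_iff_forall_sq_eq_one Δ hD4).1 h)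

/-- **THEOREM A ∕ A′ «⇐» on Euler's squarefree convenient numbers, unconditionally.** -/
theorem lineLaw_sufficiency_euler {k : ℕ} (hk : k ∈ eulerConvenientNumbers) (hsq : Squarefree (k : ℤ))
    (ns : List ℕ) (hrep : ∀ n ∈ ns, 0 < n ∧ ∃ x y : ℤ, x ^ 2 + k * y ^ 2 = n ∧ IsCoprime x y)
    (e : ℕ) (h2 : k % 4 = 3 → ∀ n ∈ ns, 2 ∣ n → 2 ^ e ∣ n ∧ ¬ 2 ^ (e + 1) ∣ n) :
    ∃ A : ℤ, ∀ n ∈ ns, ∃ z : ℤ√(-(k : ℤ)), z.norm = n ∧ z ∣ (⟨A, -1⟩ : ℤ√(-(k : ℤ))) ∧ IsCoprime z.re z.im := by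
  obtain ⟨hk0, -⟩ := euler_forall_ambiguous k hk
  have hh := classNumber_eq_of_euler hk
  have hm : (-(k : ℤ)) < 0 := by omega
  have hsq' : Squarefree (-(k : ℤ)) := fun d hd => hsq d (dvd_neg.1 hd)
  have hrep' : ∀ n ∈ ns, 0 < n ∧ ∃ x y : ℤ, x ^ 2 - (-(k : ℤ)) * y ^ 2 = n ∧ IsCoprime x y := by
    intro n hn
    obtain ⟨hpos, x, y, hxy, hc⟩ := hrep n hn
    exact ⟨hpos, x, y, by linear_combination hxy, hc⟩
  have hk4 : ¬ 4 ∣ k := by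
    rintro ⟨t, rfl⟩
    have h2 : ¬ IsUnit (2 : ℤ) := by rw [Int.isUnit_iff]; omega
    exact h2 (hsq 2 ⟨t, by push_cast; ring⟩)
  by_cases hk3 : k % 4 = 3
  · exact lineLaw_sufficiency_one_mod_four hm (by omega) hsq' hh ns hrep' e (h2 hk3)
  · exact lineLaw_sufficiency_two_three hm (by omega) hsq' hh ns hrep'

/-- **The per-weight capture on Euler's squarefree list, any weight**: `n = x² + k y² > 0` primitive, `A² + k = n·k₀`, `n` or `k₀`
odd ⇒ a primitive `z ∈ ℤ√−k` with `N z = n` divides `A − √−k`. -/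
theorem capture_euler_all {k : ℕ} (hk : k ∈ eulerConvenientNumbers) (hsq : Squarefree (k : ℤ)) {n k₀ A x y : ℤ}
    (hn : 0 < n) (hk₀ : A ^ 2 - n * k₀ = -(k : ℤ)) (hrep : x ^ 2 + k * y ^ 2 = n) (hxy : IsCoprime x y)
    (h2 : Odd n ∨ Odd k₀) :
    ∃ z : ℤ√(-(k : ℤ)), z.norm = n ∧ z ∣ (⟨A, -1⟩ : ℤ√(-(k : ℤ))) ∧ IsCoprime z.re z.im := by
  obtain ⟨hk0, -⟩ := euler_forall_ambiguous k hk
  exact capture_all_of_parity (by omega) (fun d hd => hsq d (dvd_neg.1 hd)) (classNumber_eq_of_euler hk) hn hk₀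
    (by linear_combination hrep) hxy h2

/-- **Instance in numbers (`k = 21 = 3·7`, squarefree, `k ≡ 1 (mod 4)`, in Euler's list; `h(−84) = 4 = 2^{μ−1}`)**: the EVEN
quotient `22 = N(1 + √−21)` and the RAMIFIED quotient `21 = N(√−21)` share the root `A = 21`: `21² + 21 = 462 = 22·21`, and
`(1 + √−21)·(−√−21) = 21 − √−21 = √−21·(−1 − √−21)`. -/
example : (21 : ℕ) ∈ eulerConvenientNumbers ∧ (21 : ℤ) ^ 2 + 21 = 22 * 21 ∧
    (⟨1, 1⟩ : ℤ√(-21)) * ⟨0, -1⟩ = ⟨21, -1⟩ ∧ (⟨0, 1⟩ : ℤ√(-21)) * ⟨-1, -1⟩ = ⟨21, -1⟩ := by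
  refine ⟨by decide, by norm_num, by ext <;> simp, by ext <;> simp⟩

end Summit.Ventures.HSemireg.LineLawEulerSufficiency
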